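import Summits.BirchSwinnertonDyer.BirchSwinnertonDyer.Theorems.AlignedTransportAtTwoMainConjectureOfRankZeroBSDAtTwoCubicOrderFourDoor
import Literature.NumberTheory.IwasawaTheory.ClassGroupLayerTwoOrderFourOfTowerCertificate
import HarnessLib

/-!
# Route `AlignedTransportAtTwo`, crux C2 `MainConjectureOfRankZeroBSDAtTwo` (stmt-BirchSwinnertonDyer-22298):
# THE LAYER-TWO ORDER-FOUR DOOR — a class of ORDER `4` in `Cl(K_2)`, `K_2 = ℚ(β, √2, √(2+√2)) = ℚ(β)·ℚ(ζ₁₆)⁺`, for the cubic `2`-torsion field of a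
# curve with `Δ_W < 0` and irreducible `W[2]`, from a TOWER ORDER-FOUR CERTIFICATE written in `𝓞_{ℚ(β)}`; hence `μ₂ = 0`, `λ₂ ≤ 2` via att-p3 g47's door

HONEST FRAMING (cell `bsd-f1-sign2`, WIDTH-5 attached prover seat `bsd-line-att-p4` gen 41 on line `birth` of the lead `bsd-line-att-p2`;
`--supports` stmt-BirchSwinnertonDyer-22298, closes nothing; BSD is NOT proved by any of this; the crux C2, its verdict «blocked-on
`Rank1Residual.GreenbergMuConjectureIrreducible`» and every registered stub are untouched).  THEOREMS ONLY — no definition, no named fact, no `sorry`.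

WHY / WHAT.  On the HARD CORE of the u7 sub-cell (`t = 3 ∧ e₁ = 1`: `N = 1259, 3027, 3523, 14891`; `9139`) every kit-free lever of the cell was
exhausted until att-p3 g47's ELEMENTARY-LAYER DOOR: ONE ideal class of order `4` in some layer `Cl(K_k)` forces `rank₂ Cl(K_m) ≤ 2^k − 2 ∀ m`,
`μ₂ = 0`, `λ₂ ≤ 2^k − 2`.  The census (att-p4 g39 §2b) says `Cl(K_2)[2^∞] ≅ (ℤ/4)²` at `3027`, `9139`.  This door KERNELISES the datum at `k = 2`:
this seat's Literature theorems `NumberFields.exists_orderOf_eq_four_of_towerOrderFourCert` (g40's order-four certificate one quadratic step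
higher: `n ≥ rank E_{K_2} = 7` units modulo `±` squares by residue symbols computed in `𝓞_{ℚ(β)}`, an ideal `(q₀, v)` with `(q₀,v)² = (w,q₀²)` not
principal and `(w,q₀²)² = (w)`), `NumberFields.towerCert_of_charMatrix` (the `2⁹ − 1` residue certificates from NINE characters and one `𝔽₂`-matrix
identity) and `IwasawaTheory.exists_orderOf_eq_four_layer_two_of_towerCert` (the `ℤ₂`-tower packaging: every datum an identity between
`𝓞_{ℚ(β)}`-coordinates on `1, s₁, s₂, s₁s₂`).
* **`exists_orderOf_eq_four_layer_two_adjoin_of_towerCert`** — `W/ℚ` elliptic with no rational `2`-torsion abscissa and `Δ_W < 0`, `β` a root of the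
  `2`-division cubic, `2 ∤ d_{ℚ(β)}`, `n ≥ 7` units and the certificate data ⟹ `∃ c ∈ Cl(K_2)`, `orderOf c = 4` for every cyclotomic `ℤ₂`-extension
  of `ℚ(β)` (the class of `(q₀, v)`).
First customer (same seat, separate files): `N = 3027` (`[1,0,1,−19,29]`, `d = −3027`, `h = 1`, `t = 3`, `e₁ = 1`).

Nothing is asserted about `μ₂` or `MC₂` here; nothing is closed; BSD is not proved.

References: [NeukirchANT1999] Ch. I §2, §3, §7 Thm. (7.4), §8; [Cohen1993] §6.5; [Washington1997] §13.1, §13.3; [Serre1973CourseArithmetic] Ch. I §3;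
[SilvermanAEC2009] III.§1; tree: this seat's Literature `NumberFields/SqrtTwoTowerOrderFourClassCertificate`,
`IwasawaTheory/ClassGroupLayerTwoOrderFourOfTowerCertificate`, g40's `…CubicOrderFourDoor` (`r₁(ℚ(β)) = 1`, `#Pl_∞ = 2`).
-/

set_option linter.dupNamespace false
set_option autoImplicit false

noncomputable section

open scoped Classical NumberField nonZeroDivisors

namespace Summit.BirchSwinnertonDyer.BirchSwinnertonDyer.Theorems.AlignedTransportAtTwoCubicLayerTwoOrderFourDoor

open NumberField IsDedekindDomain Polynomial WeierstrassCurve IntermediateField CongruenceSubgroup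
  Literature.NumberTheory.IwasawaTheory Literature.NumberTheory.GaloisRepresentations
  Literature.NumberTheory.EllipticCurves Literature.NumberTheory.EllipticCurves.Greenberg1999
  Literature.NumberTheory.EllipticCurves.ModularForms
  Literature.NumberTheory.EllipticCurves.Rank1Residual
  Literature.NumberTheory.EllipticCurves.Module
  Literature.NumberTheory.NumberFields
  Summit.BirchSwinnertonDyer.Rank1Residual
  Summit.BirchSwinnertonDyer.Rank1Residual.X1.MuLambda
  Summit.BirchSwinnertonDyer.Rank1Residual.X5
  Summit.BirchSwinnertonDyer.Rank1Residual.F1Sign2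
  Summit.BirchSwinnertonDyer.BirchSwinnertonDyer.Theorems.Rank1ResidualX1Defs
  Summit.BirchSwinnertonDyer.BirchSwinnertonDyer.Theses.AlignedTransportAtTwo
  Summit.BirchSwinnertonDyer.BirchSwinnertonDyer.Theorems.AlignedTransportAtTwoCubicCarrierRoad
  Summit.BirchSwinnertonDyer.BirchSwinnertonDyer.Theorems.AlignedTransportAtTwoCubicLayerOneDoors

variable (W : WeierstrassCurve ℚ) [W.IsElliptic]

/-- **A CLASS OF ORDER `4` IN `Cl(K_2)` FOR THE CUBIC `2`-TORSION FIELD FROM A TOWER ORDER-FOUR CERTIFICATE.**  `W/ℚ` elliptic with no rational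
`2`-torsion abscissa (`[ℚ(β):ℚ] = 3`) and `Δ_W < 0` (two infinite places, so `rank E_{K_2} = 7`), `β ∈ ℚ̄` a root of the `2`-division cubic, `2 ∤ d_{ℚ(β)}`,
`κ` a cyclotomic `ℤ₂`-extension of `ℚ(β)` (`K_1 = ℚ(β, s₁)`, `s₁² = 2`; `K_2 = K_1(s₂)`, `s₂² = 2 + s₁`).  DATA in `𝓞_{ℚ(β)}` (coordinates on `1, s₁, s₂, s₁s₂`,
products by `s₁² = 2`, `s₂² = 2 + s₁`): `n ≥ 7` units `a_i` with inverses `c_i`; `w = A`, `w* = W` with `q₀⁴ = w w*`; Bézout `μ w + ν w* = 1`; `q₀ ≠ 0`;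
`v`, `V = v²`, and witnesses `q₀ v = α w + β q₀²`, `V = γ w + δ q₀²`, `w = m q₀² + n'(q₀ v) + l V`; and for every `(e, e', ±) ≠ (0, 0, +)` a residue certificate
(`ψ : 𝓞_{ℚ(β)} → ℤ/q`, `2t = 1`, `r₁² = 2`, `r₂² = 2 + r₁`, `±∏ sym(a_i)^{e_i}·sym(A)^{e'}` not a square).  THEN for every cyclotomic `ℤ₂`-extension `κ` of `ℚ(β)`
the class group of the second layer has an element of ORDER `4` (the class of `(q₀, v)`).
[cite: NeukirchANT1999, Ch. I §7 Thm. (7.4), Ch. I §3, Ch. I §8] [cite: Cohen1993, §6.5] [cite: Washington1997, §13.1] -/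
theorem exists_orderOf_eq_four_layer_two_adjoin_of_towerCert (ht : ∀ x : ℚ, ¬ HasRationalTwoTorsionX W x) (hΔ : W.Δ < 0)
    {β : AlgebraicClosure ℚ} (hβ : aeval β W.twoTorsionPolynomial.toPoly = 0)
    (hd : haveI : FiniteDimensional ℚ ↥(IntermediateField.adjoin ℚ ({β} : Set (AlgebraicClosure ℚ))) :=
        IntermediateField.adjoin.finiteDimensional ((AlgebraicClosure.isAlgebraic ℚ).isAlgebraic β).isIntegral
      haveI : NumberField ↥(IntermediateField.adjoin ℚ ({β} : Set (AlgebraicClosure ℚ))) := NumberField.mk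
      ¬ (2 : ℤ) ∣ NumberField.discr ↥(IntermediateField.adjoin ℚ ({β} : Set (AlgebraicClosure ℚ))))
    {n : ℕ} (hn : 7 ≤ n)
    (a₀ a₁ a₂ a₃ c₀ c₁ c₂ c₃ : Fin n → 𝓞 ↥(IntermediateField.adjoin ℚ ({β} : Set (AlgebraicClosure ℚ))))
    {A₀ A₁ A₂ A₃ W₀ W₁ W₂ W₃ μ₀ μ₁ μ₂ μ₃ ν₀ ν₁ ν₂ ν₃ q₀ v₀ v₁ v₂ v₃ α₀ α₁ α₂ α₃ β₀ β₁ β₂ β₃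
      γ₀ γ₁ γ₂ γ₃ δ₀ δ₁ δ₂ δ₃ m₀ m₁ m₂ m₃ n₀ n₁ n₂ n₃ l₀ l₁ l₂ l₃ V₀ V₁ V₂ V₃ : 𝓞 ↥(IntermediateField.adjoin ℚ ({β} : Set (AlgebraicClosure ℚ)))}
    (hu : ∀ i, a₀ i * c₀ i + 2 * a₁ i * c₁ i + 2 * (a₂ i * c₂ i + 2 * a₃ i * c₃ i) + 2 * (a₂ i * c₃ i + a₃ i * c₂ i) = 1 ∧
      a₀ i * c₁ i + a₁ i * c₀ i + (a₂ i * c₂ i + 2 * a₃ i * c₃ i) + 2 * (a₂ i * c₃ i + a₃ i * c₂ i) = 0 ∧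
      a₀ i * c₂ i + 2 * a₁ i * c₃ i + a₂ i * c₀ i + 2 * a₃ i * c₁ i = 0 ∧
      a₀ i * c₃ i + a₁ i * c₂ i + a₂ i * c₁ i + a₃ i * c₀ i = 0)
    (hws : q₀ ^ 4 = A₀ * W₀ + 2 * A₁ * W₁ + 2 * (A₂ * W₂ + 2 * A₃ * W₃) + 2 * (A₂ * W₃ + A₃ * W₂) ∧
      (0 : 𝓞 ↥(IntermediateField.adjoin ℚ ({β} : Set (AlgebraicClosure ℚ)))) = A₀ * W₁ + A₁ * W₀ + (A₂ * W₂ + 2 * A₃ * W₃) + 2 * (A₂ * W₃ + A₃ * W₂) ∧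
      (0 : 𝓞 ↥(IntermediateField.adjoin ℚ ({β} : Set (AlgebraicClosure ℚ)))) = A₀ * W₂ + 2 * A₁ * W₃ + A₂ * W₀ + 2 * A₃ * W₁ ∧
      (0 : 𝓞 ↥(IntermediateField.adjoin ℚ ({β} : Set (AlgebraicClosure ℚ)))) = A₀ * W₃ + A₁ * W₂ + A₂ * W₁ + A₃ * W₀)
    (hbez : (μ₀ * A₀ + 2 * μ₁ * A₁ + 2 * (μ₂ * A₂ + 2 * μ₃ * A₃) + 2 * (μ₂ * A₃ + μ₃ * A₂)) +
        (ν₀ * W₀ + 2 * ν₁ * W₁ + 2 * (ν₂ * W₂ + 2 * ν₃ * W₃) + 2 * (ν₂ * W₃ + ν₃ * W₂)) = 1 ∧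
      (μ₀ * A₁ + μ₁ * A₀ + (μ₂ * A₂ + 2 * μ₃ * A₃) + 2 * (μ₂ * A₃ + μ₃ * A₂)) +
        (ν₀ * W₁ + ν₁ * W₀ + (ν₂ * W₂ + 2 * ν₃ * W₃) + 2 * (ν₂ * W₃ + ν₃ * W₂)) = 0 ∧
      (μ₀ * A₂ + 2 * μ₁ * A₃ + μ₂ * A₀ + 2 * μ₃ * A₁) + (ν₀ * W₂ + 2 * ν₁ * W₃ + ν₂ * W₀ + 2 * ν₃ * W₁) = 0 ∧
      (μ₀ * A₃ + μ₁ * A₂ + μ₂ * A₁ + μ₃ * A₀) + (ν₀ * W₃ + ν₁ * W₂ + ν₂ * W₁ + ν₃ * W₀) = 0)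
    (hq₀ : q₀ ≠ 0)
    (hM2 : q₀ * v₀ = (α₀ * A₀ + 2 * α₁ * A₁ + 2 * (α₂ * A₂ + 2 * α₃ * A₃) + 2 * (α₂ * A₃ + α₃ * A₂)) + β₀ * q₀ ^ 2 ∧
      q₀ * v₁ = (α₀ * A₁ + α₁ * A₀ + (α₂ * A₂ + 2 * α₃ * A₃) + 2 * (α₂ * A₃ + α₃ * A₂)) + β₁ * q₀ ^ 2 ∧
      q₀ * v₂ = (α₀ * A₂ + 2 * α₁ * A₃ + α₂ * A₀ + 2 * α₃ * A₁) + β₂ * q₀ ^ 2 ∧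
      q₀ * v₃ = (α₀ * A₃ + α₁ * A₂ + α₂ * A₁ + α₃ * A₀) + β₃ * q₀ ^ 2)
    (hV : v₀ * v₀ + 2 * v₁ * v₁ + 2 * (v₂ * v₂ + 2 * v₃ * v₃) + 2 * (v₂ * v₃ + v₃ * v₂) = V₀ ∧
      v₀ * v₁ + v₁ * v₀ + (v₂ * v₂ + 2 * v₃ * v₃) + 2 * (v₂ * v₃ + v₃ * v₂) = V₁ ∧
      v₀ * v₂ + 2 * v₁ * v₃ + v₂ * v₀ + 2 * v₃ * v₁ = V₂ ∧
      v₀ * v₃ + v₁ * v₂ + v₂ * v₁ + v₃ * v₀ = V₃)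
    (hM3 : V₀ = (γ₀ * A₀ + 2 * γ₁ * A₁ + 2 * (γ₂ * A₂ + 2 * γ₃ * A₃) + 2 * (γ₂ * A₃ + γ₃ * A₂)) + δ₀ * q₀ ^ 2 ∧
      V₁ = (γ₀ * A₁ + γ₁ * A₀ + (γ₂ * A₂ + 2 * γ₃ * A₃) + 2 * (γ₂ * A₃ + γ₃ * A₂)) + δ₁ * q₀ ^ 2 ∧
      V₂ = (γ₀ * A₂ + 2 * γ₁ * A₃ + γ₂ * A₀ + 2 * γ₃ * A₁) + δ₂ * q₀ ^ 2 ∧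
      V₃ = (γ₀ * A₃ + γ₁ * A₂ + γ₂ * A₁ + γ₃ * A₀) + δ₃ * q₀ ^ 2)
    (hM4 : A₀ = m₀ * q₀ ^ 2 + (n₀ * (q₀ * v₀) + 2 * n₁ * (q₀ * v₁) + 2 * (n₂ * (q₀ * v₂) + 2 * n₃ * (q₀ * v₃)) +
        2 * (n₂ * (q₀ * v₃) + n₃ * (q₀ * v₂))) + (l₀ * V₀ + 2 * l₁ * V₁ + 2 * (l₂ * V₂ + 2 * l₃ * V₃) + 2 * (l₂ * V₃ + l₃ * V₂)) ∧
      A₁ = m₁ * q₀ ^ 2 + (n₀ * (q₀ * v₁) + n₁ * (q₀ * v₀) + (n₂ * (q₀ * v₂) + 2 * n₃ * (q₀ * v₃)) +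
        2 * (n₂ * (q₀ * v₃) + n₃ * (q₀ * v₂))) + (l₀ * V₁ + l₁ * V₀ + (l₂ * V₂ + 2 * l₃ * V₃) + 2 * (l₂ * V₃ + l₃ * V₂)) ∧
      A₂ = m₂ * q₀ ^ 2 + (n₀ * (q₀ * v₂) + 2 * n₁ * (q₀ * v₃) + n₂ * (q₀ * v₀) + 2 * n₃ * (q₀ * v₁)) +
        (l₀ * V₂ + 2 * l₁ * V₃ + l₂ * V₀ + 2 * l₃ * V₁) ∧
      A₃ = m₃ * q₀ ^ 2 + (n₀ * (q₀ * v₃) + n₁ * (q₀ * v₂) + n₂ * (q₀ * v₁) + n₃ * (q₀ * v₀)) +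
        (l₀ * V₃ + l₁ * V₂ + l₂ * V₁ + l₃ * V₀))
    (hcert : ∀ (e : Fin n → ℕ) (e' : ℕ) (σ : ℤˣ), (∀ i, e i ≤ 1) → e' ≤ 1 → ¬ (e = 0 ∧ e' = 0 ∧ σ = 1) →
      ∃ (q : ℕ) (ψ : 𝓞 ↥(IntermediateField.adjoin ℚ ({β} : Set (AlgebraicClosure ℚ))) →+* ZMod q) (t r₁ r₂ : ZMod q), 2 * t = 1 ∧ r₁ ^ 2 = 2 ∧ r₂ ^ 2 = 2 + r₁ ∧
        ¬ IsSquare (((σ : ℤ) : ZMod q) *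
          (∏ i, (ψ (a₀ i) + ψ (a₁ i) * r₁ + (ψ (a₂ i) + ψ (a₃ i) * r₁) * r₂) ^ e i) *
          (ψ A₀ + ψ A₁ * r₁ + (ψ A₂ + ψ A₃ * r₁) * r₂) ^ e'))
    (κP : ZpExtension ↥(IntermediateField.adjoin ℚ ({β} : Set (AlgebraicClosure ℚ))) 2) (hκP : κP.IsCyclotomic) :
    ∃ c : ClassGroup (𝓞 (κP.layer 2)), orderOf c = 4 := by
  have hirr := AlignedTransportAtTwoSeed.irr_two_of_forall_not_hasRationalTwoTorsionX W ht
  have hβint : IsIntegral ℚ β := ((AlgebraicClosure.isAlgebraic ℚ).isAlgebraic β).isIntegral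
  haveI : FiniteDimensional ℚ ↥(IntermediateField.adjoin ℚ ({β} : Set (AlgebraicClosure ℚ))) := IntermediateField.adjoin.finiteDimensional hβint
  haveI : NumberField ↥(IntermediateField.adjoin ℚ ({β} : Set (AlgebraicClosure ℚ))) := NumberField.mk
  have h3 : Module.finrank ℚ ↥(IntermediateField.adjoin ℚ ({β} : Set (AlgebraicClosure ℚ))) = 3 := AddKatoTwo.finrank_adjoin_root_twoTorsionPolynomial_eq_three W hirr hβ
  have hodd3 : ¬ 2 ∣ Module.finrank ℚ ↥(IntermediateField.adjoin ℚ ({β} : Set (AlgebraicClosure ℚ))) := by rw [h3]; decide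
  have hr1 := nrRealPlaces_adjoin_root_twoTorsionPolynomial_eq_one W hΔ hirr hβ
  have hPl : 4 * Fintype.card (InfinitePlace ↥(IntermediateField.adjoin ℚ ({β} : Set (AlgebraicClosure ℚ)))) ≤ n + 1 := by
    have h := InfinitePlace.card_add_two_mul_card_eq_rank (K := ↥(IntermediateField.adjoin ℚ ({β} : Set (AlgebraicClosure ℚ))))
    rw [h3, hr1] at h
    rw [InfinitePlace.card_eq_nrRealPlaces_add_nrComplexPlaces, hr1]
    omega
  exact exists_orderOf_eq_four_layer_two_of_towerCert hodd3 hd hPl κP hκP a₀ a₁ a₂ a₃ c₀ c₁ c₂ c₃ hu hws hbez hq₀ hM2 hV hM3 hM4 hcert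

end Summit.BirchSwinnertonDyer.BirchSwinnertonDyer.Theorems.AlignedTransportAtTwoCubicLayerTwoOrderFourDoor

end
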